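import Literature.IUT.HodgeTheaters.PiAvatarNFLabPull
import HarnessLib

/-!
# The NF-kit slot `labPull` IS the genuine transport of label classes of cusps ([IUTchI] Ex 4.5 (i)): on a morphism `†𝒟_v̲ → †𝒟^⊚` whose
# base element fixes the zero cusp — every `φ^NF`-type morphism — the multiplier `labPullChar` is the action of the base element on the
# nonzero `±`-classes of cusps `LabCusp(𝒟^⊚) = |Cusp(X̲_K)| ∖ {0}` read through the canonical labelling (proof-only; post-freeze additive D13)

S. Mochizuki, *Inter-universal Teichmüller theory I*, kurims manuscript (May 2020), Ex 4.5 (i) pp. 107–108 («by considering cuspidal inertia groups of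
`π₁(𝒟^⊚)` whose unique index `l` subgroup is contained in the image of this homomorphism … a natural isomorphism of `𝔽_l^⋇`-torsors
`LabCusp(𝒟^⊚) ⥲ LabCusp(𝒟_{v̲_j})`»), Prop 4.2 p. 98 («natural bijection `LabCusp(†𝔇) ⥲ 𝔽_l^⋇`»), Def 4.1 (ii) p. 96 ([IUTchI] Ex 4.5 (i) p.107)
[claim: Mochizuki2012, status: disputed] (D-0012 claim key, series status DISPUTED — kernel theorems over abc-iut-L5-t2's REAL `InitialThetaData`,
abc-iut-L5-t1's `CuspGalois`, abc-iut-L5-t4's `hS` and local datum `δ`; nothing of the series is asserted, no side is taken on [IUTchIII] Cor. 3.12).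

WHY (honesty of the Type-0 reading, the `labPull` analogue of abc-iut-L5-t3's `absStarEquiv_gLabNFAutModel`, p437019).  The slot `labPullAmb f` of
PiAvatarNFLabPull (p450993) multiplies the canonical labels `𝔽_l^⋇` by `labPullChar f` = the slope class of the base element `d ∈ N(Π_{X̲_K})` of the
marking-reduced morphism.  Here: (1) for `d ∈ N(Π_{X̲_K})` FIXING `ε⁰` the cusp action `actF d` is LINEAR in the chart at `ε⁰` (`gChart₀Model_actF_of_actF_ε0`),
so it induces a map on the nonzero `±`-classes `|Cusp(X̲_K)| ∖ {0}` = the genuine `LabCusp(𝒟^⊚)` (abc-iut-L5-t3 gen 5) whose effect on labels is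
multiplication by the slope class (`absStarLabel_toAbs_actF`); (2) hence **`labPullChar_mul_absStarEquiv`**: `labPullChar f · label[x] = label[d·x]` whenever
the base element of `f` fixes `ε⁰`; (3) the base element of every `φ^NF`-TYPE morphism `a ≫ φ^NF_{•,v̲} ≫ b` fixes `ε⁰` (`actF_ε0_of_autConj`: automorphisms of
`𝒟_v̲` by (L2), automorphisms of `𝒟^⊚` by `actF_nf_ε0`, elements of `Π_{C̲_K}` by `actF_ε0_of_mem_PiCund`) — so on the morphisms the kit singles out
(`NFKit.HomNF`) the slot IS print's induced bijection of label classes, read through Prop 4.2's canonical labelling on both sides.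
Proof-only; no instance, no notation; typed ≠ proved elsewhere.
-/

noncomputable section

namespace Literature.IUT.HodgeTheaters

open CategoryTheory

universe u v w

section NFLabPullCusps

variable {F : Type u} {K : Type v} {Fbar : Type w} [Field F] [NumberField F] [Field K] [NumberField K]
  [Algebra F K] [Field Fbar] [Algebra F Fbar] [Algebra K Fbar]
  {E : WeierstrassCurve F} [E.IsElliptic] {l : ℕ} {Pb : BadPlacePredicates K}
  (D : InitialThetaData F K Fbar E l Pb) (CG : D.geom.pe.CuspGalois) (hS : D.CuspClassesNormaliserStable) [Fact l.Prime]

namespace InitialThetaData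

/-! ### Elements of `N(Π_{X̲_K})` fixing `ε⁰` act linearly and move nonzero `±`-classes by their slope class -/

/-- **Linearity**: an element of `N(Π_{X̲_K})` fixing the zero cusp acts by `z ↦ (slope)·z` in the chart at `ε⁰` (affineness with vanishing
translation). ([IUTchI] Def 6.1 (v) p.158) [claim: Mochizuki2012, status: disputed] -/
theorem gChart₀Model_actF_of_actF_ε0 (n : ↥(Subgroup.normalizer ((D.PiXund : Subgroup D.PiC) : Set D.PiC)))
    (h0 : D.actF CG hS n D.geom.pe.ε0 = D.geom.pe.ε0) (x : D.geom.pe.Cusp) :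
    D.gChart₀Model CG (D.actF CG hS n x) = D.actFSlope CG hS n * D.gChart₀Model CG x := by
  rw [D.gChart₀Model_actF CG hS, h0, D.gChart₀Model_ε0 CG, add_zero]

/-- Such an element commutes with `−1` on the cusps. ([IUTchI] Def 6.1 (v) p.158) [claim: Mochizuki2012, status: disputed] -/
theorem actF_neg_of_actF_ε0 (n : ↥(Subgroup.normalizer ((D.PiXund : Subgroup D.PiC) : Set D.PiC)))
    (h0 : D.actF CG hS n D.geom.pe.ε0 = D.geom.pe.ε0) (x : D.geom.pe.Cusp) :
    D.actF CG hS n ((D.gLabPMModel CG).neg x) = (D.gLabPMModel CG).neg (D.actF CG hS n x) := by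
  apply (D.gChart₀Model CG).injective
  rw [D.gChart₀Model_actF_of_actF_ε0 CG hS n h0, (D.gLabPMModel CG).chart_neg (D.gChart₀Model_mem_gLabPMModel_charts CG),
    (D.gLabPMModel CG).chart_neg (D.gChart₀Model_mem_gLabPMModel_charts CG), D.gChart₀Model_actF_of_actF_ε0 CG hS n h0, mul_neg]

/-- … hence induces a map on the `±`-classes of cusps (well defined). ([IUTchI] Def 4.1 (v) p.97) [claim: Mochizuki2012, status: disputed] -/
theorem toAbs_actF_wd_of_actF_ε0 (n : ↥(Subgroup.normalizer ((D.PiXund : Subgroup D.PiC) : Set D.PiC)))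
    (h0 : D.actF CG hS n D.geom.pe.ε0 = D.geom.pe.ε0) {x y : D.geom.pe.Cusp}
    (h : (D.gLabPMModel CG).toAbs x = (D.gLabPMModel CG).toAbs y) :
    (D.gLabPMModel CG).toAbs (D.actF CG hS n x) = (D.gLabPMModel CG).toAbs (D.actF CG hS n y) := by
  rw [(D.gLabPMModel CG).toAbs_eq_toAbs_iff] at h ⊢
  rcases h with h | h
  · exact Or.inl (by rw [h])
  · exact Or.inr (by rw [h, D.actF_neg_of_actF_ε0 CG hS n h0])

/-- … preserving NONZERO classes (the slope is a unit). ([IUTchI] Def 4.1 (v) p.97) [claim: Mochizuki2012, status: disputed] -/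
theorem toAbs_actF_ne_zero_of_actF_ε0 (n : ↥(Subgroup.normalizer ((D.PiXund : Subgroup D.PiC) : Set D.PiC)))
    (h0 : D.actF CG hS n D.geom.pe.ε0 = D.geom.pe.ε0) {x : D.geom.pe.Cusp}
    (hx : (D.gLabPMModel CG).toAbs x ≠ (D.gLabPMModel CG).toAbs (D.gLabPMModel CG).zero) :
    (D.gLabPMModel CG).toAbs (D.actF CG hS n x) ≠ (D.gLabPMModel CG).toAbs (D.gLabPMModel CG).zero := by
  intro h
  apply hx
  rw [(D.gLabPMModel CG).toAbs_eq_toAbs_zero_iff,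
    ← (D.gLabPMModel CG).chart_eq_zero_iff (D.gChart₀Model_mem_gLabPMModel_charts CG)] at h ⊢
  rw [D.gChart₀Model_actF_of_actF_ε0 CG hS n h0] at h
  rcases mul_eq_zero.mp h with h1 | h1
  · exact absurd h1 (D.actFSlope_ne_zero CG hS _)
  · exact h1

/-- **The induced map on `LabCusp(𝒟^⊚) = |Cusp(X̲_K)| ∖ {0}` multiplies labels by the SLOPE CLASS**: `label [n·x] = slopeStar n * label [x]` for
`n ∈ N(Π_{X̲_K})` fixing `ε⁰`. ([IUTchI] Ex 4.5 (i) p.107) [claim: Mochizuki2012, status: disputed] -/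
theorem absStarLabel_toAbs_actF (n : ↥(Subgroup.normalizer ((D.PiXund : Subgroup D.PiC) : Set D.PiC)))
    (h0 : D.actF CG hS n D.geom.pe.ε0 = D.geom.pe.ε0) (x : D.geom.pe.Cusp)
    (hx : (D.gLabPMModel CG).toAbs x ≠ (D.gLabPMModel CG).toAbs (D.gLabPMModel CG).zero) :
    (D.gLabPMModel CG).absStarLabel ⟨(D.gLabPMModel CG).toAbs (D.actF CG hS n x), D.toAbs_actF_ne_zero_of_actF_ε0 CG hS n h0 hx⟩ =
      D.slopeStar CG hS n * (D.gLabPMModel CG).absStarLabel ⟨(D.gLabPMModel CG).toAbs x, hx⟩ := by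
  have hmem := D.gChart₀Model_mem_gLabPMModel_charts CG
  have hx0 : D.gChart₀Model CG x ≠ 0 := fun h => hx (((D.gLabPMModel CG).toAbs_eq_toAbs_zero_iff x).mpr
    (((D.gLabPMModel CG).chart_eq_zero_iff hmem x).mp h))
  have hnx0 : D.gChart₀Model CG (D.actF CG hS n x) ≠ 0 := by
    rw [D.gChart₀Model_actF_of_actF_ε0 CG hS n h0]
    exact mul_ne_zero (D.actFSlope_ne_zero CG hS _) hx0
  rw [(D.gLabPMModel CG).absStarLabel_mk, (D.gLabPMModel CG).absStarLabel_mk,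
    (D.gLabPMModel CG).starLabelOf_eq_of_mem hmem _ _ hnx0, (D.gLabPMModel CG).starLabelOf_eq_of_mem hmem _ _ hx0, slopeStar_apply]
  change (QuotientGroup.mk _ : FlStar l) = QuotientGroup.mk _ * QuotientGroup.mk _
  rw [← QuotientGroup.mk_mul]
  congr 1
  apply Units.ext
  rw [Units.val_mk0, Units.val_mul, Units.val_mk0, val_actFSlopeUnit, D.gChart₀Model_actF_of_actF_ε0 CG hS n h0]

omit [Fact l.Prime] in
/-- Fixing `ε⁰` is a property of the COSET `nΠ_{C̲_K}` (elements of `Π_{C̲_K}` fix `ε⁰`). ([IUTchI] §1 p.37) [claim: Mochizuki2012, status: disputed] -/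
theorem actF_ε0_of_mk_eq (n m : ↥(Subgroup.normalizer ((D.PiXund : Subgroup D.PiC) : Set D.PiC)))
    (h : (QuotientGroup.mk (n : D.PiC) : D.PiC ⧸ D.PiCund) = QuotientGroup.mk (m : D.PiC))
    (h0 : D.actF CG hS n D.geom.pe.ε0 = D.geom.pe.ε0) : D.actF CG hS m D.geom.pe.ε0 = D.geom.pe.ε0 := by
  have hq : ((n : D.PiC))⁻¹ * (m : D.PiC) ∈ D.PiCund := QuotientGroup.eq.mp h
  have hc := D.actF_ε0_of_mem_PiCund CG hS hq (n⁻¹ * m).2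
  have hm : m = n * (n⁻¹ * m) := by group
  rw [hm, map_mul, Equiv.Perm.mul_apply]
  exact (congrArg _ hc).trans h0

namespace LocalDatum

variable {D CG hS} (δ : D.LocalDatum CG hS)

/-! ### On morphisms whose base element fixes `ε⁰`, the slot IS the genuine transport of label classes -/

/-- **`labPull` = genuine cusp-class transport** (Ex 4.5 (i), read through Prop 4.2's canonical labelling `absStarEquiv : LabCusp(𝒟^⊚) ⥲ 𝔽_l^⋇`):
for a morphism `f : †𝒟 → †𝒟^⊚` from an isomorph of `𝒟_v̲` whose reduced base element `d` fixes `ε⁰`, `labPullChar f · label[x] = label[d·x]` for every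
nonzero `±`-class `[x]` of cusps. ([IUTchI] Ex 4.5 (i) p.107) [claim: Mochizuki2012, status: disputed] -/
theorem labPullChar_mul_absStarEquiv {X : D.PiAmbient} (hX : Nonempty (X ≅ δ.locObj)) {Y : D.GlobNF} (f : X ⟶ Y.obj)
    {d : ↥(Subgroup.normalizer ((D.PiXund : Subgroup D.PiC) : Set D.PiC))}
    (hd : nfBaseCoset (δ.nfReduce hX f) = (QuotientGroup.mk (d : D.PiC) : D.PiC ⧸ D.PiCund))
    (h0 : D.actF CG hS d D.geom.pe.ε0 = D.geom.pe.ε0) (x : D.geom.pe.Cusp)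
    (hx : (D.gLabPMModel CG).toAbs x ≠ (D.gLabPMModel CG).toAbs (D.gLabPMModel CG).zero) :
    δ.labPullChar f * (D.gLabPMModel CG).absStarEquiv ⟨(D.gLabPMModel CG).toAbs x, hx⟩ =
      (D.gLabPMModel CG).absStarEquiv
        ⟨(D.gLabPMModel CG).toAbs (D.actF CG hS d x), D.toAbs_actF_ne_zero_of_actF_ε0 CG hS d h0 hx⟩ := by
  rw [δ.labPullChar_of_loc f hX, hd, D.nfCosetChar_mk CG hS, FlPMGroup.absStarEquiv_apply, FlPMGroup.absStarEquiv_apply,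
    D.absStarLabel_toAbs_actF CG hS d h0 x hx]

/-! ### `φ^NF`-type morphisms have `ε⁰`-fixing base elements -/

/-- At the models the markings are identities: the reduced morphism of `f : 𝒟_v̲ → 𝒟^⊚` is `f`. ([IUTchI] Def 4.1 (vi) p.97) [claim: Mochizuki2012, status: disputed] -/
theorem nfReduce_model (f : δ.locObj ⟶ D.gBaseObj) : δ.nfReduce ⟨Iso.refl _⟩ (Y := D.gnfModel) f = f := by
  rw [nfReduce, δ.locMark_locObj, D.nfMarkAmb_gnfModel]
  exact (Category.id_comp _).trans (Category.comp_id _)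

/-- An automorphism of `𝒟_v̲` fixes `ε⁰` on the labels ((L2): it reads `z ↦ ±z`). ([IUTchI] Def 6.1 (iii) p.157) [claim: Mochizuki2012, status: disputed] -/
theorem actF_ε0_of_mem_normalizer {n : D.PiC} (hn : n ∈ Subgroup.normalizer ((δ.H : Subgroup D.PiC) : Set D.PiC)) :
    D.actF CG hS ⟨n, δ.law.normalizer_le hn⟩ D.geom.pe.ε0 = D.geom.pe.ε0 := by
  obtain ⟨ε, hε⟩ := δ.law.sign n hn (δ.law.normalizer_le hn)
  apply (D.gChart₀Model CG).injective
  rw [hε, D.gChart₀Model_ε0 CG, smul_zero]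

/-- **The base element of a `φ^NF`-type morphism `α ≫ φ^NF_{•,v̲} ≫ β` (`α ∈ Aut(𝒟_v̲)`, `β ∈ Aut(𝒟^⊚)`) fixes `ε⁰`** — whichever representative
`d` of its base coset: `d ∈ n·m·Π_{C̲_K}` with `n ∈ N(Π_v̲)` (fixes `ε⁰` by (L2)), `m ∈ N(Π_{C̲_K})` (`actF_nf_ε0`), `Π_{C̲_K}` (`actF_ε0_of_mem_PiCund`).
([IUTchI] Ex 4.3 (ii) p.99) [claim: Mochizuki2012, status: disputed] -/
theorem actF_ε0_of_autConj (α : δ.locObj ≅ δ.locObj) (β : Aut (D.gBaseObj))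
    {d : ↥(Subgroup.normalizer ((D.PiXund : Subgroup D.PiC) : Set D.PiC))}
    (hd : nfBaseCoset (α.hom ≫ δ.phiNFAmb ≫ β.hom) = (QuotientGroup.mk (d : D.PiC) : D.PiC ⧸ D.PiCund)) :
    D.actF CG hS d D.geom.pe.ε0 = D.geom.pe.ε0 := by
  obtain ⟨n, hn, rfl⟩ := OrbitCat.exists_eq_autOfNormalizer α
  obtain ⟨m, hm, rfl⟩ := OrbitCat.exists_eq_autOfNormalizer β
  have hnX : n ∈ Subgroup.normalizer ((D.PiXund : Subgroup D.PiC) : Set D.PiC) := δ.law.normalizer_le hn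
  have hmX : m ∈ Subgroup.normalizer ((D.PiXund : Subgroup D.PiC) : Set D.PiC) := D.normalizer_PiCund_le_normalizer_PiXund hm
  have h1 : nfBaseCoset (δ.phiNFAmb ≫ (OrbitCat.autOfNormalizer m hm).hom) = (QuotientGroup.mk ((1 : D.PiC) * m) : D.PiC ⧸ D.PiCund) :=
    nfBaseCoset_comp_aut hm δ.phiNFAmb δ.nfBaseCoset_phiNFAmb
  have h2 : nfBaseCoset ((OrbitCat.autOfNormalizer n hn).hom ≫ δ.phiNFAmb ≫ (OrbitCat.autOfNormalizer m hm).hom) =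
      (QuotientGroup.mk (n * ((1 : D.PiC) * m)) : D.PiC ⧸ D.PiCund) := by
    rw [nfBaseCoset_aut_comp hn, h1]
    rfl
  rw [h2] at hd
  have hmem : n * ((1 : D.PiC) * m) ∈ Subgroup.normalizer ((D.PiXund : Subgroup D.PiC) : Set D.PiC) :=
    Subgroup.mul_mem _ hnX (Subgroup.mul_mem _ (Subgroup.one_mem _) hmX)
  refine D.actF_ε0_of_mk_eq CG hS ⟨n * ((1 : D.PiC) * m), hmem⟩ d hd ?_
  have e : (⟨n * ((1 : D.PiC) * m), hmem⟩ : ↥(Subgroup.normalizer ((D.PiXund : Subgroup D.PiC) : Set D.PiC))) =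
      ⟨n, hnX⟩ * D.nfNormalizerIncl ⟨m, hm⟩ := Subtype.ext (show n * ((1 : D.PiC) * m) = n * m by rw [one_mul])
  rw [e, map_mul, Equiv.Perm.mul_apply, D.actF_nf_ε0 CG hS ⟨m, hm⟩]
  exact δ.actF_ε0_of_mem_normalizer hn

/-- **On `φ^NF`-TYPE morphisms at the models the slot IS print's induced bijection of label classes** (Ex 4.5 (i), read through Prop 4.2's canonical
labelling): for `f = α ≫ φ^NF_{•,v̲} ≫ β` with base representative `d`, `labPullChar f · label[x] = label[d·x]` for every nonzero `±`-class of cusps.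
([IUTchI] Ex 4.5 (i) p.107) [claim: Mochizuki2012, status: disputed] -/
theorem labPullChar_autConj_mul_absStarEquiv (α : δ.locObj ≅ δ.locObj) (β : Aut (D.gBaseObj))
    {d : ↥(Subgroup.normalizer ((D.PiXund : Subgroup D.PiC) : Set D.PiC))}
    (hd : nfBaseCoset (α.hom ≫ δ.phiNFAmb ≫ β.hom) = (QuotientGroup.mk (d : D.PiC) : D.PiC ⧸ D.PiCund)) (x : D.geom.pe.Cusp)
    (hx : (D.gLabPMModel CG).toAbs x ≠ (D.gLabPMModel CG).toAbs (D.gLabPMModel CG).zero) :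
    δ.labPullChar (Y := D.gnfModel) (α.hom ≫ δ.phiNFAmb ≫ β.hom) * (D.gLabPMModel CG).absStarEquiv ⟨(D.gLabPMModel CG).toAbs x, hx⟩ =
      (D.gLabPMModel CG).absStarEquiv
        ⟨(D.gLabPMModel CG).toAbs (D.actF CG hS d x), D.toAbs_actF_ne_zero_of_actF_ε0 CG hS d (δ.actF_ε0_of_autConj α β hd) hx⟩ := by
  have hd' : nfBaseCoset (δ.nfReduce ⟨Iso.refl _⟩ (Y := D.gnfModel) (α.hom ≫ δ.phiNFAmb ≫ β.hom)) =
      (QuotientGroup.mk (d : D.PiC) : D.PiC ⧸ D.PiCund) := by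
    rw [δ.nfReduce_model]; exact hd
  exact δ.labPullChar_mul_absStarEquiv ⟨Iso.refl _⟩ _ hd' (δ.actF_ε0_of_autConj α β hd) x hx

end LocalDatum

end InitialThetaData

end NFLabPullCusps

end Literature.IUT.HodgeTheaters
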